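import Summits.CriticalPhenomena.SAWScalingLimit.Theorems.SAWLoopFugacityFlowAvoidanceLimitTaggiKesten
import Summits.CriticalPhenomena.SAWScalingLimit.Theorems.SAWLoopFugacityFlowAvoidanceLimitMassiveBelow
import Literature.Probability.RandomPlanarGeometry.SAWPatternTheorem
import Mathlib.Analysis.SpecificLimits.Basic

/-!
# A positive loop fugacity keeps the loop-dressed SAW massive strictly ABOVE `1/μ` — registered stub
`isMassive_above_criticalFugacity_of_pos` (helper of `stub_cornerLipschitz`, line `saw-corner-germ`,
crux `SAWLoopFugacityFlow.AvoidanceLimit`, stmt-CriticalPhenomena-10649)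

A Taggi-2018-type theorem for the strictly dilute loop-dressed self-avoiding walk `Z_{n,0,y}` (tree
`DiluteLoopModel ⟨n, 0, y⟩`, the `t = 0` slice of the Anchor objects) on `ℤ²`: for every loop
fugacity `n > 0` there is `y₁ > x_c = 1/μ` such that the corner-to-corner two-leg function of the
lattice square `[0, k]²` is `≤ e^{-mk}` eventually, for EVERY edge fugacity `y ∈ [0, y₁]` — the
massive interval of the line's critical curve `critLine n` extends strictly beyond the SAW point
(`critLine 0 = 1/μ`, stubs `massiveBelow` / `notMassiveAbove`). This is the rigorous lower half of
"`x_c(n)` moves at first order in `n`"; L. Taggi proved the analogous strict shift for the loop O(`n`)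
model (ECP 23 (2018), Thm 1.1). Proof (two pages on top of Kesten's pattern theorem, which is
PROVED in the tree, `SAW.Zd.thm723`):

1. `twoLegDim_le_sum_paths_penalty` (file `…TaggiKesten`): the two-leg function is at most the sum
   over self-avoiding paths `γ` of `y^{|γ|} (1 + n y⁴)^{-J(γ)}`, `J(γ)` = number of occurrences of
   Kesten's pattern `(V, Q)` on `γ` (each occurrence carries a walk-supported plaquette, and
   plaquettes only raise the source-free partition function, file `…TaggiPlaquettes`);
2. group the paths by length `N ≥ 2k` and inject them into the `N`-step SAWs from `0`
   (`getVert_sub_mem_saws`, `getVert_sub_injective`); by Kesten's theorem at most `((1-ε)μ)^N` of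
   them have `J ≤ N/q`, the others are penalised by `(1 + n x_c⁴)^{-N/q} = γ^{-N}` (for `y ≥ x_c`),
   `γ = (1 + n x_c⁴)^{1/q} > 1`, and there are at most `c_N ≤ K((1+η)μ)^N` of them
   (`SAW.Zd.count_le_mul_pow`);
3. with `y₁ = (1+η)/μ`, `η = min(1, ε, (γ-1)/4)`, both rates `(1-ε)(1+η)` and `(1+η)²/γ` are `< 1`, so
   the length-`N` layer weighs `≤ (1+K)θ^N`, `θ < 1`, and the geometric tail over `N ≥ 2k` is
   `≤ θ^k = e^{-mk}` eventually (`sum_fibre_le`); below `x_c` the statement is the landed stub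
   `stub_massiveBelow` transported to `n ≥ 0` by `isMassive_of_isMassive_zero`.

Sources: L. Taggi, *Shifted critical threshold in the loop O(n) model at arbitrarily small n*,
Electron. Commun. Probab. 23 (2018), paper no. 96, Thm 1.1 [Taggi2018]; N. Madras, G. Slade, *The
Self-Avoiding Walk* (1993), Theorem 7.2.3 (Kesten's pattern theorem) and §1.2 [MadrasSlade1993];
H. Kesten, J. Math. Phys. 4 (1963) 960. No definitions; the registered statement is UNFOLDED into tree
vocabulary (`sqBox k = (box 2 k).filter (∀ i, 0 ≤ v i)`).
-/

noncomputable section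

open Finset Filter Topology
open scoped symmDiff
open Literature.Probability.RandomPlanarGeometry Literature.Probability.LatticeModels
open Summit.CriticalPhenomena.SAWScalingLimit.Theorems.AvoidanceLimit.Anchor

namespace Summit.CriticalPhenomena.SAWScalingLimit.Theorems.AvoidanceLimit.Corner

section Dictionary

open SimpleGraph

/-- **Paths are walks of the vertex-function model**: the vertex function `i ↦ γ(i) - a` of a
self-avoiding path `γ` of `ℤ²` from `a` is an `|γ|`-step self-avoiding walk from `0` in the sense of
`SAW.Zd.saws` (starts at `0`, nearest-neighbour steps, frozen after time `|γ|`, injective on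
`[0, |γ|]`). [cite: MadrasSlade1993, §1.1] -/
theorem getVert_sub_mem_saws {a b : Site 2} {p : (zdGraph 2).Walk a b} (hp : p.IsPath) :
    (fun i => p.getVert i - a) ∈ SAW.Zd.saws 2 p.length := by
  refine SAW.Zd.mem_saws.2 ⟨by simp, fun i hi => ?_, fun i hi => ?_, fun i hi j hj hij => ?_⟩
  · simp only [p.getVert_of_length_le hi, p.getVert_length]
  · exact (SAW.Zd.zdGraph_adj_sub_right _ _ _).2 (p.adj_getVert_succ hi)
  · exact hp.getVert_injOn hi hj (sub_left_inj.1 hij)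

/-- A walk is determined by its (recentred) vertex function. [folklore] -/
theorem getVert_sub_injective (a b : Site 2) :
    Function.Injective fun p : (zdGraph 2).Walk a b => fun i => p.getVert i - a := by
  intro p q h
  exact Walk.ext_getVert fun k => sub_left_inj.1 (congrFun h k)

end Dictionary

section Assembly

/-- **The length-`N` layer of the penalised path sum decays geometrically above `x_c`.** Let
`q, ε, N₀` be as in Kesten's pattern theorem for `(V, Q)` (`SAW.Zd.thm723 0`), `K, η > 0` with
`c_N ≤ K((1+η)μ)^N` for all `N`, and `β > 1`, `γ ≥ 1` with `γ^q ≤ β`. Then for `N ≥ N₀`, every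
edge fugacity `0 ≤ y` with `μ y ≤ 1 + η` and `β ≤ 1 + n y⁴`, every volume `Λ` and endpoint `b`:
`Σ_{γ ∈ pathsIn ℤ² Λ 0 b, |γ| = N} y^N (1 + n y⁴)^{-J(γ)} ≤ ((1-ε)(1+η))^N + K ((1+η)²/γ)^N` — inject
the paths into the `N`-step SAWs from `0`; those with `J ≤ N/q` are at most `((1-ε)μ)^N` in number
(penalty dropped), the others carry `(1 + n y⁴)^{-(N/q + 1)} ≤ β^{-(N/q+1)} ≤ γ^{-N}` and are at most
`c_N ≤ K((1+η)μ)^N` in number. [cite: Taggi2018, proof of Thm 1.1] -/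
theorem sum_fibre_le {n : ℝ} {q : ℕ} (hq : 0 < q) {ε : ℝ} (hε1 : ε < 1) {N₀ : ℕ}
    (hPT : ∀ N, N₀ ≤ N → (#((SAW.Zd.saws 2 N).filter (fun ω => SAW.Zd.vCount N ω ≤ N / q)) : ℝ) ≤
      ((1 - ε) * SAW.connectiveConstant) ^ N)
    {K η : ℝ} (hK0 : 0 ≤ K) (hη : 0 ≤ η)
    (hK : ∀ N : ℕ, (SAW.Zd.count 2 N : ℝ) ≤ K * ((1 + η) * SAW.connectiveConstant) ^ N)
    {β γ : ℝ} (hβ1 : 1 < β) (hγ1 : 1 ≤ γ) (hγq : γ ^ q ≤ β) {y : ℝ} (hy0 : 0 ≤ y)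
    (hμy : SAW.connectiveConstant * y ≤ 1 + η) (hβy : β ≤ 1 + n * y ^ 4) (Λ : Finset (Site 2))
    (b : Site 2) {N : ℕ} (hN : N₀ ≤ N) :
    ∑ p ∈ (DiluteLoopModel.pathsIn (zdGraph 2) Λ 0 b).filter (fun p => p.length = N),
        y ^ p.length / (1 + n * y ^ 4) ^ SAW.Zd.vCount p.length (fun i => p.getVert i - 0) ≤
      ((1 - ε) * (1 + η)) ^ N + K * ((1 + η) ^ 2 / γ) ^ N := by
  classical
  set P := DiluteLoopModel.pathsIn (zdGraph 2) Λ 0 b with hPdef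
  set μ : ℝ := SAW.connectiveConstant with hμdef
  have hμ : 0 < μ := SAW.Zd.connectiveConstant_pos 2
  have hγ0 : 0 < γ := one_pos.trans_le hγ1
  set f : (ℕ → Site 2) → ℝ := fun ω => y ^ N / β ^ SAW.Zd.vCount N ω with hf
  -- Step 1: bound by `f` of the vertex function and inject into the `N`-step SAWs
  have h1 : ∑ p ∈ P.filter (fun p => p.length = N),
        y ^ p.length / (1 + n * y ^ 4) ^ SAW.Zd.vCount p.length (fun i => p.getVert i - 0) ≤
      ∑ p ∈ P.filter (fun p => p.length = N), f (fun i => p.getVert i - 0) := by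
    refine sum_le_sum fun p hp => ?_
    obtain ⟨-, hpN⟩ := mem_filter.1 hp
    rw [hpN]
    exact div_le_div_of_nonneg_left (pow_nonneg hy0 _) (pow_pos (one_pos.trans hβ1) _)
      (pow_le_pow_left₀ (zero_le_one.trans hβ1.le) hβy _)
  have h2 : ∑ p ∈ P.filter (fun p => p.length = N), f (fun i => p.getVert i - 0) ≤
      ∑ ω ∈ SAW.Zd.saws 2 N, f ω := by
    rw [← sum_image (s := P.filter (fun p => p.length = N)) (g := fun p => fun i => p.getVert i - 0)
      (f := f) fun p _ p' _ h => getVert_sub_injective 0 b h]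
    refine sum_le_sum_of_subset_of_nonneg ?_ fun ω _ _ =>
      div_nonneg (pow_nonneg hy0 _) (pow_nonneg (zero_le_one.trans hβ1.le) _)
    rw [image_subset_iff]
    intro p hp
    obtain ⟨hpP, hpN⟩ := mem_filter.1 hp
    rw [← hpN]
    exact getVert_sub_mem_saws (DiluteLoopModel.mem_pathsIn.1 hpP).1
  -- Step 2: split the SAWs according to the number of patterns
  have hγN : γ ^ N ≤ β ^ (N / q + 1) :=
    calc γ ^ N ≤ γ ^ (q * (N / q + 1)) := pow_le_pow_right₀ hγ1 (Nat.lt_mul_div_succ N hq).le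
      _ = (γ ^ q) ^ (N / q + 1) := pow_mul _ _ _
      _ ≤ β ^ (N / q + 1) := pow_le_pow_left₀ (pow_nonneg hγ0.le _) hγq _
  have hfew : ∑ ω ∈ (SAW.Zd.saws 2 N).filter (fun ω => SAW.Zd.vCount N ω ≤ N / q), f ω ≤
      ((1 - ε) * (1 + η)) ^ N :=
    calc ∑ ω ∈ (SAW.Zd.saws 2 N).filter (fun ω => SAW.Zd.vCount N ω ≤ N / q), f ω
        ≤ ∑ ω ∈ (SAW.Zd.saws 2 N).filter (fun ω => SAW.Zd.vCount N ω ≤ N / q), y ^ N :=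
          sum_le_sum fun ω _ => div_le_self (pow_nonneg hy0 _) (one_le_pow₀ hβ1.le)
      _ = (#((SAW.Zd.saws 2 N).filter (fun ω => SAW.Zd.vCount N ω ≤ N / q)) : ℝ) * y ^ N := by
          rw [sum_const, nsmul_eq_mul]
      _ ≤ ((1 - ε) * μ) ^ N * y ^ N := mul_le_mul_of_nonneg_right (hPT N hN) (pow_nonneg hy0 _)
      _ = ((1 - ε) * (μ * y)) ^ N := by rw [← mul_pow, mul_assoc]
      _ ≤ ((1 - ε) * (1 + η)) ^ N :=
          pow_le_pow_left₀ (mul_nonneg (by linarith) (mul_nonneg hμ.le hy0))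
            (mul_le_mul_of_nonneg_left hμy (by linarith)) N
  have hmany : ∑ ω ∈ (SAW.Zd.saws 2 N).filter (fun ω => ¬SAW.Zd.vCount N ω ≤ N / q), f ω ≤
      K * ((1 + η) ^ 2 / γ) ^ N :=
    calc ∑ ω ∈ (SAW.Zd.saws 2 N).filter (fun ω => ¬SAW.Zd.vCount N ω ≤ N / q), f ω
        ≤ ∑ ω ∈ (SAW.Zd.saws 2 N).filter (fun ω => ¬SAW.Zd.vCount N ω ≤ N / q), y ^ N / γ ^ N := by
          refine sum_le_sum fun ω hω => ?_
          obtain ⟨-, hω⟩ := mem_filter.1 hω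
          exact div_le_div_of_nonneg_left (pow_nonneg hy0 _) (pow_pos hγ0 _)
            (hγN.trans (pow_le_pow_right₀ hβ1.le (by omega)))
      _ = (#((SAW.Zd.saws 2 N).filter (fun ω => ¬SAW.Zd.vCount N ω ≤ N / q)) : ℝ) *
            (y ^ N / γ ^ N) := by rw [sum_const, nsmul_eq_mul]
      _ ≤ (SAW.Zd.count 2 N : ℝ) * (y ^ N / γ ^ N) := by
          refine mul_le_mul_of_nonneg_right ?_ (div_nonneg (pow_nonneg hy0 _) (pow_nonneg hγ0.le _))
          exact_mod_cast (card_filter_le _ _).trans (SAW.Zd.card_saws 2 N).le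
      _ ≤ K * ((1 + η) * μ) ^ N * (y ^ N / γ ^ N) :=
          mul_le_mul_of_nonneg_right (hK N) (div_nonneg (pow_nonneg hy0 _) (pow_nonneg hγ0.le _))
      _ = K * (((1 + η) * (μ * y)) ^ N / γ ^ N) := by rw [mul_pow, mul_pow, mul_pow]; ring
      _ ≤ K * (((1 + η) * (1 + η)) ^ N / γ ^ N) := by
          refine mul_le_mul_of_nonneg_left (div_le_div_of_nonneg_right ?_ (pow_nonneg hγ0.le _)) hK0
          exact pow_le_pow_left₀ (mul_nonneg (by linarith) (mul_nonneg hμ.le hy0))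
            (mul_le_mul_of_nonneg_left hμy (by linarith)) N
      _ = K * ((1 + η) ^ 2 / γ) ^ N := by rw [div_pow, sq]
  calc ∑ p ∈ P.filter (fun p => p.length = N),
        y ^ p.length / (1 + n * y ^ 4) ^ SAW.Zd.vCount p.length (fun i => p.getVert i - 0)
      ≤ ∑ ω ∈ SAW.Zd.saws 2 N, f ω := h1.trans h2
    _ = ∑ ω ∈ (SAW.Zd.saws 2 N).filter (fun ω => SAW.Zd.vCount N ω ≤ N / q), f ω +
          ∑ ω ∈ (SAW.Zd.saws 2 N).filter (fun ω => ¬SAW.Zd.vCount N ω ≤ N / q), f ω :=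
        (sum_filter_add_sum_filter_not _ _ _).symm
    _ ≤ ((1 - ε) * (1 + η)) ^ N + K * ((1 + η) ^ 2 / γ) ^ N := add_le_add hfew hmany

/-- **Registered stub · a positive loop fugacity keeps the loop-dressed SAW massive strictly above
`1/μ`** (Taggi-type strict shift of the critical fugacity, for the two-leg line of the strictly dilute
loop-dressed SAW on `ℤ²`). For every `n > 0` there is `y₁ > x_c = 1/μ` such that for every edge
fugacity `y ∈ [0, y₁]` the corner-to-corner normalised two-leg function
`twoLegDim n 0 y ℤ² [0,k]² 0 (k,k)` is `≤ e^{-mk}` for some `m > 0` and all large `k`. Below `x_c` this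
is the pure-SAW statement (`stub_massiveBelow`, loops only lower the two-leg function); on
`[x_c, y₁]`, `y₁ = (1+η) x_c`, it is Kesten's pattern theorem (`SAW.Zd.thm723`) plus the plaquette
penalty: each of the `≥ N/q` patterns of a typical `N`-step walk can be dressed by a unit loop of
weight `n y⁴`, which the source-free partition function in the denominator contains and the walk
forbids. [cite: Taggi2018, Thm 1.1] -/
theorem isMassive_above_criticalFugacity_of_pos :
    ∀ n : ℝ, 0 < n → ∃ y₁ : ℝ, SAW.criticalFugacity < y₁ ∧ ∀ y ∈ Set.Icc 0 y₁, ∃ m : ℝ, 0 < m ∧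
      ∀ᶠ k : ℕ in atTop, twoLegDim n 0 y (zdGraph 2) ((box 2 k).filter fun v => ∀ i, 0 ≤ v i) 0 (SAW.diag k) ≤
        Real.exp (-(m * k)) := by
  intro n hn
  classical
  -- Kesten's pattern theorem for `(V, Q)` on `ℤ²`, and the growth of `c_N`
  obtain ⟨q, hq, ε, hε, hε1, N₀, hPT⟩ := SAW.Zd.thm723 0
  have hPT' : ∀ N, N₀ ≤ N → (#((SAW.Zd.saws 2 N).filter (fun ω => SAW.Zd.vCount N ω ≤ N / q)) : ℝ) ≤
      ((1 - ε) * SAW.connectiveConstant) ^ N := fun N hN => hPT N hN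
  have hμ : 0 < SAW.connectiveConstant := SAW.Zd.connectiveConstant_pos 2
  have hxc : SAW.criticalFugacity = SAW.connectiveConstant⁻¹ := rfl
  have hxc0 : 0 < SAW.criticalFugacity := by rw [hxc]; exact inv_pos.2 hμ
  have hμxc : SAW.connectiveConstant * SAW.criticalFugacity = 1 := by
    rw [hxc, mul_inv_cancel₀ hμ.ne']
  -- the penalty base `β = 1 + n x_c⁴ > 1` and its `q`-th root `γ > 1`
  set β : ℝ := 1 + n * SAW.criticalFugacity ^ 4 with hβdef
  have hβ1 : 1 < β := by
    have := mul_pos hn (pow_pos hxc0 4)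
    rw [hβdef]
    linarith
  have hq0 : (0 : ℝ) < q := by exact_mod_cast hq
  set γ : ℝ := β ^ (1 / (q : ℝ)) with hγdef
  have hγ1 : 1 < γ := Real.one_lt_rpow hβ1 (by positivity)
  have hγq : γ ^ q = β := by
    rw [← Real.rpow_natCast, hγdef, ← Real.rpow_mul (zero_le_one.trans hβ1.le),
      one_div_mul_cancel hq0.ne', Real.rpow_one]
  -- the margin `η`
  set η : ℝ := min 1 (min ε ((γ - 1) / 4)) with hηdef
  have hη0 : 0 < η := lt_min one_pos (lt_min hε (by linarith))
  have hη1 : η ≤ 1 := min_le_left _ _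
  have hηε : η ≤ ε := (min_le_right _ _).trans (min_le_left _ _)
  have hηγ : η ≤ (γ - 1) / 4 := (min_le_right _ _).trans (min_le_right _ _)
  obtain ⟨K, hK1, hK⟩ := SAW.Zd.count_le_mul_pow 2 hη0
  have hK' : ∀ N : ℕ, (SAW.Zd.count 2 N : ℝ) ≤ K * ((1 + η) * SAW.connectiveConstant) ^ N :=
    fun N => hK N
  -- the two rates and their maximum `θ < 1`
  set θ₁ : ℝ := (1 - ε) * (1 + η) with hθ₁def
  set θ₂ : ℝ := (1 + η) ^ 2 / γ with hθ₂def
  have hθ₁0 : 0 < θ₁ := mul_pos (by linarith) (by linarith)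
  have hθ₁1 : θ₁ < 1 := by
    have h1 : θ₁ ≤ (1 - ε) * (1 + ε) := mul_le_mul_of_nonneg_left (by linarith) (by linarith)
    nlinarith [mul_pos hε hε]
  have hθ₂0 : 0 < θ₂ := div_pos (by positivity) (by linarith)
  have hθ₂1 : θ₂ < 1 := by
    rw [hθ₂def, div_lt_one (by linarith)]
    nlinarith [mul_nonneg (sub_nonneg.2 hη1) hη0.le]
  set θ : ℝ := max θ₁ θ₂ with hθdef
  have hθ0 : 0 < θ := lt_max_of_lt_left hθ₁0
  have hθ1 : θ < 1 := max_lt hθ₁1 hθ₂1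
  refine ⟨(1 + η) * SAW.criticalFugacity, lt_mul_of_one_lt_left hxc0 (by linarith), fun y hy => ?_⟩
  rcases lt_or_ge y SAW.criticalFugacity with hlt | hge
  · -- below `x_c`: the pure SAW is massive and loops only lower the two-leg function
    exact isMassive_of_isMassive_zero n y hn.le hy.1 (stub_massiveBelow y hy.1 hlt)
  -- the new regime `x_c ≤ y ≤ (1 + η) x_c`
  have hy0 : 0 ≤ y := hy.1
  have hμy : SAW.connectiveConstant * y ≤ 1 + η :=
    calc SAW.connectiveConstant * y ≤ SAW.connectiveConstant * ((1 + η) * SAW.criticalFugacity) :=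
          mul_le_mul_of_nonneg_left hy.2 hμ.le
      _ = 1 + η := by rw [mul_left_comm, hμxc, mul_one]
  have hβy : β ≤ 1 + n * y ^ 4 := by
    have h := mul_le_mul_of_nonneg_left (pow_le_pow_left₀ hxc0.le hge 4) hn.le
    rw [hβdef]
    linarith
  refine ⟨-Real.log θ, neg_pos.2 (Real.log_neg hθ0 hθ1), ?_⟩
  -- eventually `(1 + K)/(1 - θ) · θ^k ≤ 1`
  have hev : ∀ᶠ k : ℕ in atTop, (1 + K) / (1 - θ) * θ ^ k ≤ 1 := by
    have ht : Tendsto (fun k : ℕ => (1 + K) / (1 - θ) * θ ^ k) atTop (𝓝 ((1 + K) / (1 - θ) * 0)) :=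
      (tendsto_pow_atTop_nhds_zero_of_lt_one hθ0.le hθ1).const_mul _
    rw [mul_zero] at ht
    exact ht.eventually (eventually_le_nhds one_pos)
  filter_upwards [hev, eventually_ge_atTop N₀, eventually_ge_atTop 1] with k hk hkN hk1
  have hexp : Real.exp (-(-Real.log θ * k)) = θ ^ k := by
    rw [neg_mul, neg_neg, mul_comm, Real.exp_nat_mul, Real.exp_log hθ0]
  rw [hexp]
  set Λ := (box 2 k).filter (fun v => ∀ i, 0 ≤ v i) with hΛdef
  set P := DiluteLoopModel.pathsIn (zdGraph 2) Λ 0 (SAW.diag k) with hPdef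
  -- every path from `0` to `(k, k)` has length `≥ 2k ≥ k ≥ N₀`
  have hlen : ∀ p ∈ P, 2 * k ≤ p.length := fun p _ => by
    have h := SAW.Zd.normOne_le_length p
    rwa [normOne_diag] at h
  have hfib : ∀ N ∈ P.image (fun p => p.length),
      ∑ p ∈ P.filter (fun p => p.length = N),
          y ^ p.length / (1 + n * y ^ 4) ^ SAW.Zd.vCount p.length (fun i => p.getVert i - 0) ≤
        (1 + K) * θ ^ N := by
    intro N hN
    obtain ⟨p, hp, rfl⟩ := mem_image.1 hN
    have hN₀ : N₀ ≤ p.length := hkN.trans ((Nat.le_mul_of_pos_left k two_pos).trans (hlen p hp))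
    refine (sum_fibre_le hq hε1 hPT' (zero_le_one.trans hK1) hη0.le hK' hβ1 hγ1.le hγq.le hy0
      hμy hβy Λ (SAW.diag k) hN₀).trans ?_
    calc θ₁ ^ p.length + K * θ₂ ^ p.length ≤ θ ^ p.length + K * θ ^ p.length :=
          add_le_add (pow_le_pow_left₀ hθ₁0.le (le_max_left _ _) _)
            (mul_le_mul_of_nonneg_left (pow_le_pow_left₀ hθ₂0.le (le_max_right _ _) _)
              (zero_le_one.trans hK1))
      _ = (1 + K) * θ ^ p.length := by ring
  have hIco : P.image (fun p => p.length) ⊆ Ico (2 * k) (P.sup (fun p => p.length) + 1) := by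
    intro N hN
    obtain ⟨p, hp, rfl⟩ := mem_image.1 hN
    exact mem_Ico.2 ⟨hlen p hp, Nat.lt_succ_of_le (le_sup (f := fun p => p.length) hp)⟩
  calc twoLegDim n 0 y (zdGraph 2) Λ 0 (SAW.diag k)
      ≤ ∑ p ∈ P, y ^ p.length / (1 + n * y ^ 4) ^ SAW.Zd.vCount p.length (fun i => p.getVert i - 0) :=
        twoLegDim_le_sum_paths_penalty n y hn.le hy0 Λ 0 (SAW.diag k) (zero_ne_diag hk1)
    _ = ∑ N ∈ P.image (fun p => p.length), ∑ p ∈ P.filter (fun p => p.length = N),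
          y ^ p.length / (1 + n * y ^ 4) ^ SAW.Zd.vCount p.length (fun i => p.getVert i - 0) :=
        (sum_fiberwise_of_maps_to (fun p hp => mem_image_of_mem _ hp) _).symm
    _ ≤ ∑ N ∈ P.image (fun p => p.length), (1 + K) * θ ^ N := sum_le_sum hfib
    _ ≤ ∑ N ∈ Ico (2 * k) (P.sup (fun p => p.length) + 1), (1 + K) * θ ^ N :=
        sum_le_sum_of_subset_of_nonneg hIco fun N _ _ =>
          mul_nonneg (by linarith) (pow_nonneg hθ0.le _)
    _ = (1 + K) * ∑ N ∈ Ico (2 * k) (P.sup (fun p => p.length) + 1), θ ^ N := (mul_sum _ _ _).symm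
    _ ≤ (1 + K) * (θ ^ (2 * k) / (1 - θ)) :=
        mul_le_mul_of_nonneg_left (geom_sum_Ico_le_of_lt_one hθ0.le hθ1) (by linarith)
    _ = (1 + K) / (1 - θ) * θ ^ k * θ ^ k := by rw [two_mul, pow_add]; ring
    _ ≤ 1 * θ ^ k := mul_le_mul_of_nonneg_right hk (pow_nonneg hθ0.le _)
    _ = θ ^ k := one_mul _

end Assembly

end Summit.CriticalPhenomena.SAWScalingLimit.Theorems.AvoidanceLimit.Corner

end
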